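import Mathlib
import Literature.Computability.Complexity.CliqueTestGraphs
import Summits.PneNP.PneNP.Theorems.ConvexRankGatesConvexGateBlindExponentDown

/-!
# Crux `ConvexGateBlind` (stmt-PneNP-10680), line `strict-rank-conic-cover`: the matching minor of `D − J`

PERFECT-MATCHING is a READ-ONCE monotone projection of CLIQUE: on the host vertex set `E(K_n) ⊔ {hub}` join two
edge-vertices iff the edges are disjoint (constant `1`), never if they touch (constant `0`), and join the hub to the
edge-vertex of `e` by the variable `x_e`. An `(n/2 + 1)`-clique of the host graph of an input graph `x ⊆ E(K_n)` is
the hub together with a perfect matching of `K_n` inside `x` (`n/2 + 1` pairwise disjoint edges do not exist). Hence,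
in the vocabulary of the line (`ConvexRankGatesConvexGateBlindExponentDown`: `cdist`, `ConeFactorisable`):

* rows: `mRow (pmEdges M)` = hub + the edge-vertices of a perfect matching `M` of `K_{2h}` — an `(h+1)`-set;
* columns: `cVec U` = the host graph of `K_n ∖ δ(U)` for `#U` odd — `(h+1)`-clique-free (`cliqueFn_cVec`: a perfect
  matching avoiding the cut `δ(U)` would make `#U` even);
* entries: `cdist (mRow (pmEdges M)) (cVec U) = |M ∩ δ(U)|` (`cdist_mRow_cVec`: the only candidate missing host
  edges inside the row are hub–`e`, missing iff `e ∈ δ(U)`; edge-vertices of a matching are pairwise adjacent).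

So the unit-potential ("`ε = 1`", Karchmer–Wigderson slack) matrix `D_{m,k} − J` of the canonical form of the crux
contains ROTHVOSS'S ODD-CUT SLACK MATRIX `|M ∩ δ(U)| − 1` of the perfect matching polytope as a submatrix, at
`(m, k) = (C(2h,2) + 1, h + 1)` and — by the apex/isolated padding `coneFactorisable_pad` of the line — at every
`(m, h + 1 + p)` with `C(2h,2) + 1 + p ≤ m` (`matchingSlack_of_coneFactorisable_pad`, registered helper stub). The
consequence for the line (the `q = 0` slice of `stub_unitPotentialHard` from Rothvoss's `2^{Ω(n)}` bound, `n ≈ √m`) is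
drawn in `ConvexRankGatesConvexGateBlindUnitPotentialLP.lean`. Everything here is finite combinatorics. [folklore];
the KW-slack/EF connection is Hrubeš 2012 / Göös–Jain–Watson 2016 §2 (`M(F; F_KW)[x,y] = |x ∩ ȳ| − 1`).
-/


namespace Summit.PneNP.PneNP.Cruxes.ConvexGateBlind.StrictRankConicCover

open Matrix Finset Filter Literature.Computability.Complexity

noncomputable section

section matching

variable {n : ℕ}

/-- The number of edges of `K_n` (`= C(n,2)`): the edge-vertices of the host graph. [folklore] -/
def NE (n : ℕ) : ℕ := Fintype.card (Edge n)

/-- The host vertex set `Fin (NE n + 1)` is `Option (Edge n)`: `some e` = the edge-vertex of `e ∈ E(K_n)`,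
`none` = the HUB. [folklore] -/
def hostEquiv (n : ℕ) : Fin (NE n + 1) ≃ Option (Edge n) :=
  finSuccEquivLast.trans (Equiv.optionCongr (Fintype.equivFin (Edge n)).symm)

/-- The hub vertex. [folklore] -/
def hub (n : ℕ) : Fin (NE n + 1) := (hostEquiv n).symm none

/-- The edge-vertex of an edge of `K_n`. [folklore] -/
def vtx (e : Edge n) : Fin (NE n + 1) := (hostEquiv n).symm (some e)

/-- The hub is `none`. [folklore] -/
@[simp] theorem hostEquiv_hub : hostEquiv n (hub n) = none := by simp [hub]

/-- Edge-vertices are `some`. [folklore] -/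
@[simp] theorem hostEquiv_vtx (e : Edge n) : hostEquiv n (vtx e) = some e := by simp [vtx]

/-- Distinct edges have distinct edge-vertices. [folklore] -/
theorem vtx_injective : Function.Injective (vtx (n := n)) := fun e e' h => by
  simpa [vtx] using h

/-- An edge-vertex is not the hub. [folklore] -/
theorem vtx_ne_hub (e : Edge n) : vtx e ≠ hub n := fun h => by
  have := congrArg (hostEquiv n) h
  simp at this

/-- Every host vertex is the hub or an edge-vertex. [folklore] -/
theorem host_cases (v : Fin (NE n + 1)) : v = hub n ∨ ∃ e : Edge n, v = vtx e := by
  cases h : hostEquiv n v with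
  | none => exact Or.inl ((hostEquiv n).injective (by simp [h]))
  | some e => exact Or.inr ⟨e, (hostEquiv n).injective (by simp [h])⟩

/-- The ROW of a set `E` of edges of `K_n`: its edge-vertices together with the hub. [folklore] -/
def mRow (E : Finset (Edge n)) : Finset (Fin (NE n + 1)) := insert (hub n) (E.map ⟨vtx, vtx_injective⟩)

/-- Membership in a row. [folklore] -/
theorem mem_mRow {E : Finset (Edge n)} {v : Fin (NE n + 1)} :
    v ∈ mRow E ↔ v = hub n ∨ ∃ e ∈ E, vtx e = v := by
  simp [mRow]

/-- The hub lies in every row. [folklore] -/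
@[simp] theorem hub_mem_mRow (E : Finset (Edge n)) : hub n ∈ mRow E := by simp [mRow]

/-- The edge-vertex of `e` lies in the row of `E` iff `e ∈ E`. [folklore] -/
@[simp] theorem vtx_mem_mRow {E : Finset (Edge n)} {e : Edge n} : vtx e ∈ mRow E ↔ e ∈ E := by
  rw [mem_mRow]
  constructor
  · rintro (h | ⟨e', he', hee'⟩)
    · exact absurd h (vtx_ne_hub e)
    · rwa [← vtx_injective hee']
  · exact fun h => Or.inr ⟨e, h, rfl⟩

/-- A row has `#E + 1` vertices. [folklore] -/
theorem card_mRow (E : Finset (Edge n)) : (mRow E).card = E.card + 1 := by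
  rw [mRow, Finset.card_insert_of_notMem, Finset.card_map]
  simp only [Finset.mem_map, Function.Embedding.coeFn_mk, not_exists, not_and]
  exact fun e _ => vtx_ne_hub e

/-- Two edges of `K_n` TOUCH if they share an endpoint. [folklore] -/
def Touch (e e' : Edge n) : Prop := ∃ v : Fin n, v ∈ (e : Sym2 (Fin n)) ∧ v ∈ (e' : Sym2 (Fin n))

/-- Touching is symmetric. [folklore] -/
theorem touch_comm {e e' : Edge n} : Touch e e' ↔ Touch e' e :=
  ⟨fun ⟨v, h1, h2⟩ => ⟨v, h2, h1⟩, fun ⟨v, h1, h2⟩ => ⟨v, h2, h1⟩⟩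

/-- An edge `e` of `K_n` lies in the CUT `δ(U)`: `e = s(x, y)` with `x ∈ U`, `y ∉ U` (the literal shape used by
`Literature.Computability.Complexity.rothvoss_matching_slack_bound`). [folklore] -/
def InCut (U : Finset (Fin n)) (e : Sym2 (Fin n)) : Prop := ∃ x ∈ U, ∃ y ∉ U, e = s(x, y)

/-- `s(x, y)` is cut by `U` iff exactly one of `x`, `y` lies in `U`. [folklore] -/
theorem inCut_mk {U : Finset (Fin n)} {x y : Fin n} :
    InCut U s(x, y) ↔ (x ∈ U ∧ y ∉ U) ∨ (y ∈ U ∧ x ∉ U) := by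
  constructor
  · rintro ⟨a, ha, b, hb, hab⟩
    rcases Sym2.eq_iff.1 hab with ⟨rfl, rfl⟩ | ⟨rfl, rfl⟩
    · exact Or.inl ⟨ha, hb⟩
    · exact Or.inr ⟨ha, hb⟩
  · rintro (⟨hx, hy⟩ | ⟨hy, hx⟩)
    · exact ⟨x, hx, y, hy, rfl⟩
    · exact ⟨y, hy, x, hx, Sym2.eq_swap⟩

/-- The COLUMN relation on `Option (Edge n)` for an odd set `U`: two edge-vertices are adjacent iff the edges do not
touch; the hub is adjacent to the edge-vertex of `e` iff `e ∉ δ(U)`. [folklore] -/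
def CRel (U : Finset (Fin n)) : Option (Edge n) → Option (Edge n) → Prop
  | some e, some e' => ¬ Touch e e'
  | none, some e => ¬ InCut U e
  | some e, none => ¬ InCut U e
  | none, none => False

/-- The column relation is symmetric. [folklore] -/
theorem cRel_comm (U : Finset (Fin n)) : ∀ a b, CRel U a b ↔ CRel U b a
  | some e, some e' => by simp only [CRel, touch_comm]
  | none, some e => Iff.rfl
  | some e, none => Iff.rfl
  | none, none => Iff.rfl

/-- The column graph on the host vertices. [folklore] -/
def cGraph (U : Finset (Fin n)) : SimpleGraph (Fin (NE n + 1)) :=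
  SimpleGraph.fromRel fun v w => CRel U (hostEquiv n v) (hostEquiv n w)

/-- Adjacency in the column graph. [folklore] -/
theorem cGraph_adj (U : Finset (Fin n)) (v w : Fin (NE n + 1)) :
    (cGraph U).Adj v w ↔ v ≠ w ∧ CRel U (hostEquiv n v) (hostEquiv n w) := by
  rw [cGraph, SimpleGraph.fromRel_adj]
  exact ⟨fun ⟨hne, h⟩ => ⟨hne, h.elim id fun h => (cRel_comm U _ _).1 h⟩, fun ⟨hne, h⟩ => ⟨hne, Or.inl h⟩⟩

/-- Two edge-vertices are adjacent iff the edges are distinct and do not touch. [folklore] -/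
theorem cGraph_adj_vtx_vtx (U : Finset (Fin n)) (e e' : Edge n) :
    (cGraph U).Adj (vtx e) (vtx e') ↔ e ≠ e' ∧ ¬ Touch e e' := by
  rw [cGraph_adj, hostEquiv_vtx, hostEquiv_vtx, vtx_injective.ne_iff]
  rfl

/-- The hub is adjacent to the edge-vertex of `e` iff `e` is not cut by `U`. [folklore] -/
theorem cGraph_adj_hub_vtx (U : Finset (Fin n)) (e : Edge n) :
    (cGraph U).Adj (hub n) (vtx e) ↔ ¬ InCut U e := by
  rw [cGraph_adj, hostEquiv_hub, hostEquiv_vtx]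
  exact ⟨fun h => h.2, fun h => ⟨(vtx_ne_hub e).symm, h⟩⟩

/-- Symmetric form of `cGraph_adj_hub_vtx`. [folklore] -/
theorem cGraph_adj_vtx_hub (U : Finset (Fin n)) (e : Edge n) :
    (cGraph U).Adj (vtx e) (hub n) ↔ ¬ InCut U e := by
  rw [SimpleGraph.adj_comm, cGraph_adj_hub_vtx]

/-- The column as an edge-indicator vector of `K_{NE n + 1}`. [folklore] -/
def cVec (U : Finset (Fin n)) : Edge (NE n + 1) → Bool :=
  fun ε => @decide ((ε : Sym2 (Fin (NE n + 1))) ∈ (cGraph U).edgeSet) (Classical.dec _)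

/-- The column vector on an explicit host edge. [folklore] -/
theorem cVec_mk (U : Finset (Fin n)) {x y : Fin (NE n + 1)} (hxy : s(x, y) ∈ (⊤ : SimpleGraph (Fin (NE n + 1))).edgeSet) :
    cVec U ⟨s(x, y), hxy⟩ = true ↔ (cGraph U).Adj x y := by
  simp only [cVec, decide_eq_true_eq, SimpleGraph.mem_edgeSet]

/-- The graph of the column vector is the column graph. [folklore] -/
theorem cliqueGraph_cVec (U : Finset (Fin n)) : cliqueGraph (cVec U) = cGraph U := by
  ext x y
  rw [cliqueGraph_adj]
  exact ⟨fun ⟨_, h⟩ => (cVec_mk U _).1 h, fun h => ⟨h.ne, (cVec_mk U _).2 h⟩⟩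


/-! ### The columns are `(h+1)`-clique-free when `#U` is odd (`n = 2h`) -/

/-- The two endpoints of an edge of `K_n`. [folklore] -/
def ends (e : Edge n) : Finset (Fin n) := univ.filter fun v => v ∈ (e : Sym2 (Fin n))

/-- Membership in the endpoint set. [folklore] -/
theorem mem_ends {e : Edge n} {v : Fin n} : v ∈ ends e ↔ v ∈ (e : Sym2 (Fin n)) := by simp [ends]

/-- The endpoints of `s(x, y)`. [folklore] -/
theorem ends_mk {x y : Fin n} (he : s(x, y) ∈ (⊤ : SimpleGraph (Fin n)).edgeSet) :
    ends (⟨s(x, y), he⟩ : Edge n) = {x, y} := by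
  ext v
  simp [mem_ends]

/-- An edge has two endpoints. [folklore] -/
theorem card_ends (e : Edge n) : (ends e).card = 2 := by
  obtain ⟨e, he⟩ := e
  induction e using Sym2.ind with
  | h x y =>
    have hxy : x ≠ y := by simpa using he
    rw [ends_mk he, card_pair hxy]

/-- Non-touching edges have disjoint endpoint sets. [folklore] -/
theorem disjoint_ends {e e' : Edge n} (h : ¬ Touch e e') : Disjoint (ends e) (ends e') :=
  Finset.disjoint_left.2 fun v hv hv' => h ⟨v, mem_ends.1 hv, mem_ends.1 hv'⟩

/-- An edge avoiding the cut `δ(U)` has `0` or `2` endpoints in `U`. [folklore] -/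
theorem even_card_inter_ends {U : Finset (Fin n)} {e : Edge n} (h : ¬ InCut U (e : Sym2 (Fin n))) :
    Even (U ∩ ends e).card := by
  obtain ⟨e, he⟩ := e
  induction e using Sym2.ind with
  | h x y =>
    have hxy : x ≠ y := by simpa using he
    have h' : ¬ InCut U s(x, y) := h
    rw [inCut_mk] at h'
    push Not at h'
    rw [ends_mk he]
    by_cases hx : x ∈ U
    · have hy : y ∈ U := h'.1 hx
      have : U ∩ {x, y} = {x, y} := Finset.inter_eq_right.2 (by simp [Finset.insert_subset_iff, hx, hy])
      rw [this, card_pair hxy]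
      exact ⟨1, rfl⟩
    · have hy : y ∉ U := fun hy => hx (h'.2 hy)
      have : U ∩ {x, y} = ∅ := by
        ext v
        simp only [Finset.mem_inter, Finset.mem_insert, Finset.mem_singleton, Finset.notMem_empty, iff_false,
          not_and]
        rintro hv (rfl | rfl)
        · exact hx hv
        · exact hy hv
      rw [this, card_empty]
      exact ⟨0, rfl⟩

/-- **Clique-freeness of the columns.** For `#U` odd and `n = 2h`, the column graph has no `(h+1)`-clique: a clique
has at most one hub, its edge-vertices are pairwise disjoint edges of `K_n` (so at most `h` of them), and `h` of them
would form a perfect matching of `K_n` avoiding the cut `δ(U)`, forcing `#U` even. [folklore] -/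
theorem cGraph_cliqueFree {U : Finset (Fin n)} (hU : Odd U.card) {h : ℕ} (hn : n = 2 * h) :
    (cGraph U).CliqueFree (h + 1) := by
  classical
  rintro S ⟨hcl, hcard⟩
  -- the edges whose edge-vertex lies in `S`
  set T : Finset (Edge n) := univ.filter fun e => vtx e ∈ S with hT
  have hTS : ∀ e, e ∈ T ↔ vtx e ∈ S := by simp [hT]
  have hpair : ∀ e ∈ T, ∀ e' ∈ T, e ≠ e' → ¬ Touch e e' := fun e he e' he' hne =>
    ((cGraph_adj_vtx_vtx U e e').1 (hcl ((hTS e).1 he) ((hTS e').1 he') (vtx_injective.ne hne))).2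
  have hsub : S ⊆ insert (hub n) (T.map ⟨vtx, vtx_injective⟩) := by
    intro v hv
    rcases host_cases v with rfl | ⟨e, rfl⟩
    · exact mem_insert_self _ _
    · exact mem_insert_of_mem (Finset.mem_map.2 ⟨e, (hTS e).2 hv, rfl⟩)
  -- the endpoints of the edges of `T`: `2 #T ≤ n`
  set B : Finset (Fin n) := T.biUnion ends with hB
  have hdisj : (T : Set (Edge n)).PairwiseDisjoint ends := fun e he e' he' hne =>
    disjoint_ends (hpair e he e' he' hne)
  have hBcard : B.card = 2 * T.card := by
    rw [hB, card_biUnion hdisj, Finset.sum_const_nat fun e _ => card_ends e, mul_comm]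
  have hBle : B.card ≤ n := by simpa using card_le_univ B
  have hScard : S.card ≤ T.card + 1 :=
    calc S.card ≤ (insert (hub n) (T.map ⟨vtx, vtx_injective⟩)).card := card_le_card hsub
      _ ≤ (T.map ⟨vtx, vtx_injective⟩).card + 1 := card_insert_le _ _
      _ = T.card + 1 := by rw [card_map]
  have hTeq : T.card = h := by omega
  have hhub : hub n ∈ S := by
    by_contra hnot
    have hsub' : S ⊆ T.map ⟨vtx, vtx_injective⟩ := fun v hv => by
      rcases mem_insert.1 (hsub hv) with rfl | h'
      · exact absurd hv hnot
      · exact h'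
    have := card_le_card hsub'
    rw [card_map] at this
    omega
  -- the hub sees every edge of `T`: none of them is cut by `U`
  have hcut : ∀ e ∈ T, ¬ InCut U (e : Sym2 (Fin n)) := fun e he =>
    (cGraph_adj_hub_vtx U e).1 (hcl hhub ((hTS e).1 he) (vtx_ne_hub e).symm)
  -- the `h` edges cover all `n = 2h` vertices
  have hBuniv : B = univ := eq_univ_of_card B (by rw [hBcard, hTeq, Fintype.card_fin, hn])
  have hUeq : U = T.biUnion fun e => U ∩ ends e := by
    rw [← Finset.inter_biUnion, ← hB, hBuniv, inter_univ]
  have hUcard : U.card = ∑ e ∈ T, (U ∩ ends e).card := by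
    conv_lhs => rw [hUeq]
    exact card_biUnion fun e he e' he' hne =>
      (disjoint_ends (hpair e he e' he' hne)).mono inter_subset_right inter_subset_right
  have heven : Even U.card := by
    rw [hUcard]
    exact Finset.even_sum _ fun e he => even_card_inter_ends (hcut e he)
  exact (Nat.not_even_iff_odd.2 hU) heven

/-- The column vector `cVec U` is `(h+1)`-clique-free (`#U` odd, `n = 2h`). [folklore] -/
theorem cliqueFn_cVec {U : Finset (Fin n)} (hU : Odd U.card) {h : ℕ} (hn : n = 2 * h) :
    cliqueFn (NE n + 1) (h + 1) (cVec U) = false := by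
  rw [cliqueFn_eq_false_iff, cliqueGraph_cVec]
  exact cGraph_cliqueFree hU hn


/-! ### The submatrix identity: `D[row(E), col(U)] = #(E ∩ δ(U))` for a matching `E` -/

/-- The host edge joining the hub to the edge-vertex of `e`. [folklore] -/
def hubEdge (e : Edge n) : Edge (NE n + 1) :=
  ⟨s(hub n, vtx e), by simpa using (vtx_ne_hub e).symm⟩

/-- `hubEdge` is injective. [folklore] -/
theorem hubEdge_injective : Function.Injective (hubEdge (n := n)) := fun e e' hee' => by
  have : s(hub n, vtx e) = s(hub n, vtx e') := congrArg Subtype.val hee'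
  exact vtx_injective (Sym2.congr_right.1 this)

/-- Which host edges inside the row of a MATCHING `E` are missing from the column of `U`: exactly the hub edges of
the cut edges of `E`. [folklore] -/
theorem missing_iff {E : Finset (Edge n)} (hE : ∀ e ∈ E, ∀ e' ∈ E, e ≠ e' → ¬ Touch e e') (U : Finset (Fin n))
    (ε : Edge (NE n + 1)) :
    (cliqueVec (mRow E) ε = true ∧ cVec U ε = false) ↔
      ∃ e ∈ E, InCut U (e : Sym2 (Fin n)) ∧ hubEdge e = ε := by
  obtain ⟨ε, hε⟩ := ε
  induction ε using Sym2.ind with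
  | h x y =>
    have hxy : x ≠ y := by simpa using hε
    have hQ : cliqueVec (mRow E) ⟨s(x, y), hε⟩ = true ↔ x ∈ mRow E ∧ y ∈ mRow E := by
      simp [cliqueVec]
    have hu : cVec U ⟨s(x, y), hε⟩ = false ↔ ¬ (cGraph U).Adj x y := by
      rw [← Bool.not_eq_true, cVec_mk]
    rw [hQ, hu]
    constructor
    · rintro ⟨⟨hx, hy⟩, hadj⟩
      rcases host_cases x with rfl | ⟨e, rfl⟩
      · rcases host_cases y with rfl | ⟨e', rfl⟩
        · exact absurd rfl hxy
        · rw [cGraph_adj_hub_vtx, not_not] at hadj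
          exact ⟨e', vtx_mem_mRow.1 hy, hadj, rfl⟩
      · rcases host_cases y with rfl | ⟨e', rfl⟩
        · rw [cGraph_adj_vtx_hub, not_not] at hadj
          exact ⟨e, vtx_mem_mRow.1 hx, hadj, Subtype.ext Sym2.eq_swap⟩
        · exfalso
          have hne : e ≠ e' := fun h => hxy (congrArg vtx h)
          exact hadj ((cGraph_adj_vtx_vtx U e e').2 ⟨hne, hE e (vtx_mem_mRow.1 hx) e' (vtx_mem_mRow.1 hy) hne⟩)
    · rintro ⟨e, heE, hcut, hεe⟩
      have hεe' : s(hub n, vtx e) = s(x, y) := congrArg Subtype.val hεe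
      rcases Sym2.eq_iff.1 hεe' with ⟨h1, h2⟩ | ⟨h1, h2⟩
      · subst h1; subst h2
        exact ⟨⟨hub_mem_mRow E, vtx_mem_mRow.2 heE⟩, by rwa [cGraph_adj_hub_vtx, not_not]⟩
      · subst h1; subst h2
        exact ⟨⟨vtx_mem_mRow.2 heE, hub_mem_mRow E⟩, by rwa [cGraph_adj_vtx_hub, not_not]⟩

open Classical in
/-- The missing host edges, as the image of the cut edges of the matching under `hubEdge`. [folklore] -/
theorem filter_missing_eq {E : Finset (Edge n)} (hE : ∀ e ∈ E, ∀ e' ∈ E, e ≠ e' → ¬ Touch e e')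
    (U : Finset (Fin n)) :
    (univ.filter fun ε : Edge (NE n + 1) => cliqueVec (mRow E) ε = true ∧ cVec U ε = false) =
      (E.filter fun e : Edge n => InCut U (e : Sym2 (Fin n))).map ⟨hubEdge, hubEdge_injective⟩ := by
  ext ε
  simp only [Finset.mem_filter, Finset.mem_univ, true_and, Finset.mem_map, Function.Embedding.coeFn_mk]
  rw [missing_iff hE U ε]
  simp only [and_assoc]

open Classical in
/-- **The submatrix identity.** For a matching `E` of `K_n` (pairwise non-touching edges) and any `U`, the one-sided
clique distance between the row of `E` and the column of `U` is the number of edges of `E` cut by `U`. [folklore] -/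
theorem cdist_mRow_cVec {E : Finset (Edge n)} (hE : ∀ e ∈ E, ∀ e' ∈ E, e ≠ e' → ¬ Touch e e')
    (U : Finset (Fin n)) :
    cdist (mRow E) (cVec U) = ((E.filter fun e : Edge n => InCut U (e : Sym2 (Fin n))).card : ℝ) := by
  unfold cdist
  rw [← Finset.natCast_card_filter, filter_missing_eq hE U, Finset.card_map]

end matching

/-- **Registered helper stub (matching host).** For `n = 2h` and `#U` odd, the column `cVec U` — the host graph of
`K_n ∖ δ(U)` under the read-once monotone projection PERFECT-MATCHING ≤ CLIQUE — is `(h+1)`-clique-free, while every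
row `mRow E` of a perfect matching `E` is an `(h+1)`-set with `cdist (mRow E) (cVec U) = |E ∩ δ(U)|`
(`cdist_mRow_cVec`): Rothvoss's odd-cut slack matrix sits inside `D − J`. [folklore] -/
theorem matchingHost_cliqueFree :
    ∀ (n h : ℕ) (U : Finset (Fin n)), Odd U.card → n = 2 * h → cliqueFn (NE n + 1) (h + 1) (cVec U) = false :=
  fun _ _ _ hU hn => cliqueFn_cVec hU hn

end

end Summit.PneNP.PneNP.Cruxes.ConvexGateBlind.StrictRankConicCover
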